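import Literature.NumberTheory.Sieve.HeathBrownCubicLeadingA
import Literature.NumberTheory.Sieve.HeathBrownMorozClassFLSequences
import HarnessLib

/-!
# Crux `HeathBrownMorozUniform` (stmt-Parity-19915), line `parent-differencing`, stub `stub_classDisplay104`, I:
# Lemma 3.2 for the CLASS pair sums `∑_{R,J} α_R β_J #𝒜_{cl,RJ}`

Helper file (`--supports stmt-Parity-19915`) towards the class display (10.4) of Heath-Brown's proof of
Lemma 3.9 (D. R. Heath-Brown, *Primes represented by `x³ + 2y³`*, Acta Math. 186 (2001), §10) for the
residue-class subfamily `classPairs X η d a b ⊆ boxPairs X η` of D. R. Heath-Brown and B. Z. Moroz,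
Proc. LMS 88 (2004), Lemma 4.1 — the registered stub `stub_classDisplay104` of the skeleton
`Cruxes/HeathBrownMorozUniform/Lines/parent_differencing.lean`.

This file is the class twin of the `PairSums` section of `Literature/…/HeathBrownCubicLeadingAPairs.lean`,
with the class Type-I main term `[(d, N D) = 1]·X_cl·ρ₂(D)/N(D)`, `X_cl = (6η²X²/π²)(ζ(2)/ζ_d(2))d⁻²`
(`classSizeA`, the main term of the landed `class_typeI_A`):

* `card_filter_dvd_eq_classCountA`, `classCountA_eq_zero_of_not_squarefree_absNorm` (Lemma 3.1 for the class,
  from `classCountA ≤ countA`), `coprime_absNorm_of_rough_of_lt` (`(d, N R) = 1` for `R` of square-free norm,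
  `z`-rough, `d < z`);
* `class_sum_pairs_abs_sub_main_le` (the core), `class_sum_pairs_main_eq` (the main terms multiply:
  `[(d, N(RJ)) = 1] = [(d, N R) = 1][(d, N J) = 1]`, and `(d, N R) = 1` on the support of `α` once `d < z`),
  `abs_sum_pairs_classCountA_sub_le` (Lemma 3.2 for signed class pair sums);
* `sum_pairs_classCountA_le_countA` (non-negative class pair sums are bounded by the parent's).

**Goldbach is not proved here**: this is bookkeeping for one stub of one line on one crux of the FRONTIER
formalisation rung `GoldbachHeathBrownDispersion` (Heath-Brown–Moroz 2004, Theorem 2).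

References: [cite: HeathBrownActa2001, Lemma 3.1, Lemma 3.2, §10 pp. 61–62];
[cite: HeathBrownMoroz2004, Lemma 2.4 and Lemma 4.1].
Tree: `HeathBrownCubicLeadingAPairs` (`isCoprime_of_isRough_of_absNorm_lt`, `squarefree_mul_of_rough_of_small`,
`squarefree_absNorm_mul_iff`, `rho₂_mul_of_coprime`, `mul_injOn_rough_small`,
`countA_eq_zero_of_not_squarefree_absNorm`, `rho₂_nonneg_le_one`), `HeathBrownMorozClassFamily`
(`classPairs`, `classAPairs`, `classCountA`, `classCountA_le_countA`), `HeathBrownMorozClassFLSequences`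
(`classSizeA`, `classSizeA_nonneg`), `HeathBrownCubicFLSequencesA` (`normSimple_of_squarefree_absNorm`,
`NormSimple.exists_prime_dvd_of_dvd_absNorm`).
-/

noncomputable section

open Polynomial NumberField Finset Filter Topology

namespace Summit.Parity.GeneralizedHardyLittlewood.Theorems.GoldbachHeathBrownDispersionHeathBrownMorozUniform

open Literature.NumberTheory.Sieve.CubicSieve Literature.NumberTheory.Sieve.CubicPrimes
open Literature.NumberTheory.LFunctions.CubeRootTwoField

/-! ### Class counts: `#𝒜_{cl,D}`, Lemma 3.1, and `(d, N R) = 1` for rough `R` -/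

section ClassCounts

variable {X η : ℝ} {d a b : ℕ}

open scoped Classical in
/-- `#{(x,y) ∈ 𝒜_cl : D ∣ (x + y·2^{1/3})} = #𝒜_{cl,D}`. [cite: HeathBrownMoroz2004, §2 (2.4)] -/
theorem card_filter_dvd_eq_classCountA (D : Ideal (𝓞 K)) :
    (#{xy ∈ classPairs X η d a b | D ∣ pairIdeal xy} : ℝ) = (classCountA X η d a b D : ℝ) := by
  simp only [classCountA, classAPairs]

/-- **Lemma 3.1 for the class**: `#𝒜_{cl,D} = 0` for a square-free ideal `D` whose norm is not square-free
(`#𝒜_{cl,D} ≤ #𝒜^(K)_D = 0`). [cite: HeathBrownActa2001, Lemma 3.1] [cite: HeathBrownMoroz2004, Lemma 2.4] -/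
theorem classCountA_eq_zero_of_not_squarefree_absNorm (hX : 0 ≤ X) {D : Ideal (𝓞 K)}
    (hD : Squarefree D) (hN : ¬Squarefree (Ideal.absNorm D)) : classCountA X η d a b D = 0 := by
  have h := classCountA_le_countA X η d a b D
  rw [countA_eq_zero_of_not_squarefree_absNorm hX hD hN] at h
  exact Nat.le_zero.mp h

/-- **`(d, N R) = 1` for `R` of square-free norm, `z`-rough, when `0 < d < z`**: a common prime `p` would be
the norm of a prime factor `P` of `R` (`N P = p` since `N R` is square-free), so `z ≤ p ≤ d < z`.
(In the class display (10.4) the weight `c_R` lives on `X^τ`-rough `R ∈ 𝒯r` and `X^τ > d`.)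
[cite: HeathBrownMoroz2004, Lemma 4.1] -/
theorem coprime_absNorm_of_rough_of_lt {z : ℝ} {R : Ideal (𝓞 K)} (hR : Squarefree (Ideal.absNorm R))
    (hRz : IsRough z R) (hd : 0 < d) (hdz : (d : ℝ) < z) : Nat.Coprime d (Ideal.absNorm R) := by
  have hR0 : R ≠ ⊥ := fun h => by rw [h, Ideal.absNorm_bot] at hR; exact not_squarefree_zero hR
  rw [Nat.coprime_iff_gcd_eq_one]
  by_contra hg
  obtain ⟨p, hp, hpg⟩ := Nat.exists_prime_and_dvd hg
  have hpd : p ∣ d := hpg.trans (Nat.gcd_dvd_left _ _)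
  have hpR : p ∣ Ideal.absNorm R := hpg.trans (Nat.gcd_dvd_right _ _)
  obtain ⟨P, hP, -, hPR, hNP⟩ :=
    (normSimple_of_squarefree_absNorm hR).exists_prime_dvd_of_dvd_absNorm hR0 hp hpR
  have h1 : z ≤ (Ideal.absNorm P : ℝ) := hRz hP hPR
  have h2 : (p : ℝ) ≤ d := by exact_mod_cast Nat.le_of_dvd hd hpd
  rw [hNP] at h1
  linarith

/-- `(d, N(RJ)) = 1 ⟺ (d, N R) = 1 ∧ (d, N J) = 1` (`N(RJ) = N(R)N(J)`). [folklore] -/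
theorem coprime_absNorm_mul_iff (R J : Ideal (𝓞 K)) :
    Nat.Coprime d (Ideal.absNorm (R * J)) ↔ Nat.Coprime d (Ideal.absNorm R) ∧ Nat.Coprime d (Ideal.absNorm J) := by
  rw [map_mul, Nat.coprime_mul_iff_right]

end ClassCounts

/-! ### Lemma 3.2 applied to the class pair sums `∑_{R,J} α_R β_J #𝒜_{cl,RJ}` -/

section PairSums

variable {X η z L Rmax A B : ℝ} {d a b : ℕ}

open scoped Classical in
/-- **The core estimate for the class.** Let `α` be supported on `z`-rough ideals `R` of square-free norm
`≤ R_max` with `|α| ≤ A`, and `β` on square-free ideals with `|β| ≤ B`; `J` runs over the ideals of norm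
`< L ≤ z`. Then, with `main_cl(D) = 𝟙[N(D) ∈ 𝒯r]·𝟙[(d, N D) = 1]·X_cl ρ₂(D)/N(D)`,
`∑_{R,J} |α_R||β_J| |#𝒜_{cl,RJ} − main_cl(RJ)| ≤ AB ∑_{N(D) ≤ R_max L, N(D) ∈ 𝒯r} |#𝒜_{cl,D} − 𝟙[(d,N D)=1]X_cl ρ₂(D)/N(D)|`
(for `RJ ∉ 𝒯r` both sides of the difference vanish by Lemma 3.1; `(R, J) ↦ RJ` is injective) — the class
twin of `sum_pairs_abs_sub_main_le`. [cite: HeathBrownActa2001, §10 pp. 61–62] [cite: HeathBrownMoroz2004, Lemma 4.1] -/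
theorem class_sum_pairs_abs_sub_main_le (hX : 0 ≤ X) (hz : L ≤ z) (hRmax : 0 ≤ Rmax)
    (𝓡 : Finset (Ideal (𝓞 K))) (α β : Ideal (𝓞 K) → ℝ)
    (hα : ∀ R ∈ 𝓡, α R ≠ 0 →
      Squarefree (Ideal.absNorm R) ∧ IsRough z R ∧ (Ideal.absNorm R : ℝ) ≤ Rmax)
    (hαA : ∀ R ∈ 𝓡, |α R| ≤ A) (hβ : ∀ J, β J ≠ 0 → Squarefree J)
    (hβB : ∀ J ∈ (idealsLE ⌊L⌋₊).filter (fun J => (Ideal.absNorm J : ℝ) < L), |β J| ≤ B)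
    (hA : 0 ≤ A) (hB : 0 ≤ B) :
    ∑ R ∈ 𝓡, ∑ J ∈ (idealsLE ⌊L⌋₊).filter (fun J => (Ideal.absNorm J : ℝ) < L),
        |α R| * |β J| * |(classCountA X η d a b (R * J) : ℝ) -
          (if Squarefree (Ideal.absNorm (R * J)) then
            (if Nat.Coprime d (Ideal.absNorm (R * J)) then
              classSizeA X η d * rho₂ (R * J) / Ideal.absNorm (R * J) else 0) else 0)| ≤
      A * B * ∑ D ∈ (idealsLE ⌊Rmax * L⌋₊).filter (fun D => Squarefree (Ideal.absNorm D)),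
        |(classCountA X η d a b D : ℝ) -
          (if Nat.Coprime d (Ideal.absNorm D) then classSizeA X η d * rho₂ D / Ideal.absNorm D else 0)| := by
  set 𝓙 := (idealsLE ⌊L⌋₊).filter (fun J => (Ideal.absNorm J : ℝ) < L) with h𝓙
  set G : Ideal (𝓞 K) → ℝ := fun D =>
    if Squarefree (Ideal.absNorm D) then |(classCountA X η d a b D : ℝ) -
      (if Nat.Coprime d (Ideal.absNorm D) then classSizeA X η d * rho₂ D / Ideal.absNorm D else 0)|
    else 0 with hG
  have hG0 : ∀ D, 0 ≤ G D := fun D => by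
    simp only [hG]; split_ifs <;> first | exact abs_nonneg _ | exact le_rfl
  set F : Ideal (𝓞 K) × Ideal (𝓞 K) → ℝ := fun RJ =>
    |α RJ.1| * |β RJ.2| * |(classCountA X η d a b (RJ.1 * RJ.2) : ℝ) -
      (if Squarefree (Ideal.absNorm (RJ.1 * RJ.2)) then
        (if Nat.Coprime d (Ideal.absNorm (RJ.1 * RJ.2)) then
          classSizeA X η d * rho₂ (RJ.1 * RJ.2) / Ideal.absNorm (RJ.1 * RJ.2) else 0) else 0)| with hF
  set P := (𝓡 ×ˢ 𝓙).filter (fun RJ => α RJ.1 ≠ 0 ∧ β RJ.2 ≠ 0) with hP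
  -- properties of the pairs in `P`
  have hPprop : ∀ RJ ∈ P, Squarefree (Ideal.absNorm RJ.1) ∧ IsRough z RJ.1 ∧
      (Ideal.absNorm RJ.1 : ℝ) ≤ Rmax ∧ Squarefree RJ.2 ∧ (Ideal.absNorm RJ.2 : ℝ) < L ∧
      RJ.1 ≠ ⊥ ∧ RJ.2 ≠ ⊥ ∧ RJ.1 ∈ 𝓡 ∧ RJ.2 ∈ 𝓙 := by
    intro RJ hRJ
    rw [hP, mem_filter, mem_product] at hRJ
    obtain ⟨⟨hR, hJ⟩, hαR, hβJ⟩ := hRJ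
    have hJL : (Ideal.absNorm RJ.2 : ℝ) < L := by
      rw [h𝓙, mem_filter] at hJ; exact hJ.2
    obtain ⟨hsq, hrough, hRm⟩ := hα RJ.1 hR hαR
    have hJsq := hβ RJ.2 hβJ
    refine ⟨hsq, hrough, hRm, hJsq, hJL, ?_, ?_, hR, hJ⟩
    · intro h; rw [h, Ideal.absNorm_bot] at hsq; exact not_squarefree_zero hsq
    · rw [Ne, ← Ideal.zero_eq_bot]; exact hJsq.ne_zero
  -- Step 1: restrict to `P` and bound termwise by `A B G(RJ)`
  have h1 : ∑ R ∈ 𝓡, ∑ J ∈ 𝓙, F (R, J) ≤ ∑ RJ ∈ P, A * B * G (RJ.1 * RJ.2) := by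
    rw [← Finset.sum_product']
    have hvan : ∀ RJ ∈ 𝓡 ×ˢ 𝓙, F RJ ≠ 0 → α RJ.1 ≠ 0 ∧ β RJ.2 ≠ 0 := by
      intro RJ _ hF0
      constructor
      · intro h; apply hF0; simp only [hF, h, abs_zero, zero_mul]
      · intro h; apply hF0; simp only [hF, h, abs_zero, mul_zero, zero_mul]
    rw [← Finset.sum_filter_of_ne hvan]
    refine Finset.sum_le_sum fun RJ hRJ => ?_
    obtain ⟨hsq, hrough, hRm, hJsq, hJL, hR0, hJ0, hRmem, hJmem⟩ := hPprop RJ hRJ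
    have hαle := hαA RJ.1 hRmem
    have hβle := hβB RJ.2 hJmem
    simp only [hF, hG]
    by_cases hsqf : Squarefree (Ideal.absNorm (RJ.1 * RJ.2))
    · rw [if_pos hsqf, if_pos hsqf]
      exact mul_le_mul_of_nonneg_right (mul_le_mul hαle hβle (abs_nonneg _) hA) (abs_nonneg _)
    · rw [if_neg hsqf, if_neg hsqf, mul_zero]
      have hsqRJ : Squarefree (RJ.1 * RJ.2) :=
        squarefree_mul_of_rough_of_small hsq hrough hJsq (hJL.trans_le hz)
      rw [classCountA_eq_zero_of_not_squarefree_absNorm hX hsqRJ hsqf]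
      simp
  -- Step 2: `(R, J) ↦ RJ` is injective on `P`, with image inside `N(D) ≤ R_max L`
  have hinj : Set.InjOn (fun RJ : Ideal (𝓞 K) × Ideal (𝓞 K) => RJ.1 * RJ.2) P := by
    rintro ⟨R, J⟩ hRJ ⟨R', J'⟩ hRJ' h
    obtain ⟨-, hrough, -, -, hJL, hR0, hJ0, -, -⟩ := hPprop _ hRJ
    obtain ⟨-, hrough', -, -, hJL', -, hJ'0, -, -⟩ := hPprop _ hRJ'
    obtain ⟨h1, h2⟩ := mul_injOn_rough_small hrough hrough' hR0 hJ0 hJ'0 (hJL.trans_le hz)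
      (hJL'.trans_le hz) h
    simp only at h1 h2
    rw [h1, h2]
  have himg : P.image (fun RJ : Ideal (𝓞 K) × Ideal (𝓞 K) => RJ.1 * RJ.2) ⊆ idealsLE ⌊Rmax * L⌋₊ := by
    intro D hD
    obtain ⟨RJ, hRJ, rfl⟩ := Finset.mem_image.mp hD
    obtain ⟨-, -, hRm, -, hJL, -, -, -, -⟩ := hPprop RJ hRJ
    rw [mem_idealsLE]
    refine Nat.le_floor ?_
    rw [map_mul, Nat.cast_mul]
    exact mul_le_mul hRm hJL.le (Nat.cast_nonneg _) hRmax
  have h2 : ∑ RJ ∈ P, A * B * G (RJ.1 * RJ.2) ≤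
      A * B * ∑ D ∈ idealsLE ⌊Rmax * L⌋₊, G D := by
    rw [← Finset.mul_sum, ← Finset.sum_image hinj]
    exact mul_le_mul_of_nonneg_left
      (Finset.sum_le_sum_of_subset_of_nonneg himg fun D _ _ => hG0 D) (mul_nonneg hA hB)
  have h3 : ∑ D ∈ idealsLE ⌊Rmax * L⌋₊, G D =
      ∑ D ∈ (idealsLE ⌊Rmax * L⌋₊).filter (fun D => Squarefree (Ideal.absNorm D)),
        |(classCountA X η d a b D : ℝ) -
          (if Nat.Coprime d (Ideal.absNorm D) then classSizeA X η d * rho₂ D / Ideal.absNorm D else 0)| := by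
    rw [Finset.sum_filter]
  calc ∑ R ∈ 𝓡, ∑ J ∈ 𝓙, F (R, J) ≤ ∑ RJ ∈ P, A * B * G (RJ.1 * RJ.2) := h1
    _ ≤ A * B * ∑ D ∈ idealsLE ⌊Rmax * L⌋₊, G D := h2
    _ = _ := by rw [h3]

open scoped Classical in
/-- **The class main terms multiply** (class twin of `sum_pairs_main_eq`): on the support of `α ⊗ β` —
`α` on `z`-rough ideals of square-free norm COPRIME TO `d` (automatic for `d < z`,
`coprime_absNorm_of_rough_of_lt`), `β` on square-free ideals, `N(J) < L ≤ z` — one has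
`N(RJ) ∈ 𝒯r ⟺ N(J) ∈ 𝒯r`, `(d, N(RJ)) = 1 ⟺ (d, N J) = 1`, `ρ₂(RJ) = ρ₂(R)ρ₂(J)`, `N(RJ) = N(R)N(J)`, so
`∑_{R,J} α_R β_J main_cl(RJ) = X_cl (∑_R α_R ρ₂(R)/N(R)) (∑_{J ∈ 𝒯r, (d, N J) = 1} β_J ρ₂(J)/N(J))` — the
factorisation of HBM's proof of Lemma 4.1 with the coprime-restricted singular sum `Σ₁^{(d)}`.
[cite: HeathBrownMoroz2004, Lemma 4.1] [cite: HeathBrownActa2001, §10 p. 62] -/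
theorem class_sum_pairs_main_eq (hz : L ≤ z) (𝓡 : Finset (Ideal (𝓞 K))) (α β : Ideal (𝓞 K) → ℝ)
    (hα : ∀ R ∈ 𝓡, α R ≠ 0 → Squarefree (Ideal.absNorm R) ∧ IsRough z R ∧ Nat.Coprime d (Ideal.absNorm R))
    (hβ : ∀ J, β J ≠ 0 → Squarefree J) :
    ∑ R ∈ 𝓡, ∑ J ∈ (idealsLE ⌊L⌋₊).filter (fun J => (Ideal.absNorm J : ℝ) < L),
        α R * β J * (if Squarefree (Ideal.absNorm (R * J)) then
          (if Nat.Coprime d (Ideal.absNorm (R * J)) then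
            classSizeA X η d * rho₂ (R * J) / Ideal.absNorm (R * J) else 0) else 0) =
      classSizeA X η d * (∑ R ∈ 𝓡, α R * (rho₂ R / Ideal.absNorm R)) *
        ∑ J ∈ ((idealsLE ⌊L⌋₊).filter (fun J => (Ideal.absNorm J : ℝ) < L)).filter
          (fun J => Squarefree (Ideal.absNorm J) ∧ Nat.Coprime d (Ideal.absNorm J)),
            β J * (rho₂ J / Ideal.absNorm J) := by
  rw [Finset.sum_filter, mul_assoc, Finset.sum_mul_sum, Finset.mul_sum]
  refine Finset.sum_congr rfl fun R hR => ?_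
  rw [Finset.mul_sum]
  refine Finset.sum_congr rfl fun J hJ => ?_
  rw [mem_filter] at hJ
  obtain ⟨-, hJL⟩ := hJ
  by_cases hαR : α R = 0
  · simp [hαR]
  by_cases hβJ : β J = 0
  · simp [hβJ]
  obtain ⟨hsq, hrough, hcopR⟩ := hα R hR hαR
  have hJsq := hβ J hβJ
  have hiff := squarefree_absNorm_mul_iff hsq hrough (hJL.trans_le hz) (J := J)
  by_cases hJn : Squarefree (Ideal.absNorm J)
  · rw [if_pos (hiff.mpr hJn)]
    have hR0 : R ≠ ⊥ := fun h => by rw [h, Ideal.absNorm_bot] at hsq; exact not_squarefree_zero hsq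
    have hJ0 : J ≠ ⊥ := fun h => by rw [h, Ideal.absNorm_bot] at hJn; exact not_squarefree_zero hJn
    have hcop := isCoprime_of_isRough_of_absNorm_lt hrough hJ0 (hJL.trans_le hz)
    by_cases hJc : Nat.Coprime d (Ideal.absNorm J)
    · rw [if_pos ((coprime_absNorm_mul_iff R J).mpr ⟨hcopR, hJc⟩), if_pos ⟨hJn, hJc⟩]
      rw [rho₂_mul_of_coprime hR0 hJ0 hcop, map_mul, Nat.cast_mul]
      have hNR : (Ideal.absNorm R : ℝ) ≠ 0 := by exact_mod_cast (Squarefree.ne_zero hsq)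
      have hNJ : (Ideal.absNorm J : ℝ) ≠ 0 := by exact_mod_cast (Squarefree.ne_zero hJn)
      field_simp
    · rw [if_neg (fun h => hJc ((coprime_absNorm_mul_iff R J).mp h).2),
        if_neg (fun h => hJc h.2)]
      simp
  · rw [if_neg (fun h => hJn (hiff.mp h)), if_neg (fun h => hJn h.1)]
    simp

open scoped Classical in
/-- **Lemma 3.2 for signed class pair sums** (class twin of `abs_sum_pairs_countA_sub_le`; the step
`U₁(𝒜_cl) = X_cl ∑ c_{R,J}[(d,N(RJ))=1]ρ₂(RJ)/N(RJ) + O(…)` of HBM's Lemma 4.1): under the support conditions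
of `class_sum_pairs_abs_sub_main_le` plus `(d, N R) = 1` on the support of `α`,
`|∑_{R,J} α_Rβ_J #𝒜_{cl,RJ} − X_cl(∑_R α_Rρ₂(R)/N(R))(∑_{J∈𝒯r,(d,N J)=1} β_Jρ₂(J)/N(J))| ≤ AB·∑_{N(D) ≤ R_maxL, D ∈ 𝒯r}|#𝒜_{cl,D} − main_cl(D)|`.
[cite: HeathBrownMoroz2004, Lemma 4.1] [cite: HeathBrownActa2001, §10 p. 62] -/
theorem abs_sum_pairs_classCountA_sub_le (hX : 0 ≤ X) (hz : L ≤ z) (hRmax : 0 ≤ Rmax)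
    (𝓡 : Finset (Ideal (𝓞 K))) (α β : Ideal (𝓞 K) → ℝ)
    (hα : ∀ R ∈ 𝓡, α R ≠ 0 →
      Squarefree (Ideal.absNorm R) ∧ IsRough z R ∧ (Ideal.absNorm R : ℝ) ≤ Rmax ∧
        Nat.Coprime d (Ideal.absNorm R))
    (hαA : ∀ R ∈ 𝓡, |α R| ≤ A) (hβ : ∀ J, β J ≠ 0 → Squarefree J)
    (hβB : ∀ J ∈ (idealsLE ⌊L⌋₊).filter (fun J => (Ideal.absNorm J : ℝ) < L), |β J| ≤ B)
    (hA : 0 ≤ A) (hB : 0 ≤ B) :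
    |∑ R ∈ 𝓡, ∑ J ∈ (idealsLE ⌊L⌋₊).filter (fun J => (Ideal.absNorm J : ℝ) < L),
        α R * β J * (classCountA X η d a b (R * J) : ℝ) -
      classSizeA X η d * (∑ R ∈ 𝓡, α R * (rho₂ R / Ideal.absNorm R)) *
        ∑ J ∈ ((idealsLE ⌊L⌋₊).filter (fun J => (Ideal.absNorm J : ℝ) < L)).filter
          (fun J => Squarefree (Ideal.absNorm J) ∧ Nat.Coprime d (Ideal.absNorm J)),
            β J * (rho₂ J / Ideal.absNorm J)| ≤
      A * B * ∑ D ∈ (idealsLE ⌊Rmax * L⌋₊).filter (fun D => Squarefree (Ideal.absNorm D)),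
        |(classCountA X η d a b D : ℝ) -
          (if Nat.Coprime d (Ideal.absNorm D) then classSizeA X η d * rho₂ D / Ideal.absNorm D else 0)| := by
  rw [← class_sum_pairs_main_eq hz 𝓡 α β
    (fun R hR h => ⟨(hα R hR h).1, (hα R hR h).2.1, (hα R hR h).2.2.2⟩) hβ]
  refine le_trans ?_ (class_sum_pairs_abs_sub_main_le hX hz hRmax 𝓡 α β
    (fun R hR h => ⟨(hα R hR h).1, (hα R hR h).2.1, (hα R hR h).2.2.1⟩) hαA hβ hβB hA hB)
  rw [← Finset.sum_sub_distrib]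
  refine (Finset.abs_sum_le_sum_abs _ _).trans (Finset.sum_le_sum fun R _ => ?_)
  rw [← Finset.sum_sub_distrib]
  refine (Finset.abs_sum_le_sum_abs _ _).trans (Finset.sum_le_sum fun J _ => ?_)
  rw [← mul_sub, abs_mul, abs_mul]

/-- **Class pair sums are dominated by the parent's** for non-negative weights:
`∑_{R,J} α_Rβ_J #𝒜_{cl,RJ} ≤ ∑_{R,J} α_Rβ_J #𝒜^(K)_{RJ}` (`𝒜_cl ⊆ 𝒜^(K)` memberwise, `classCountA_le_countA`) —
so the parent's bounds for the error terms (10.1)–(10.2) apply to the class verbatim.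
[cite: HeathBrownMoroz2004, Lemma 4.1] [cite: HeathBrownActa2001, §10 (10.1)–(10.2)] -/
theorem sum_pairs_classCountA_le_countA (𝓡 𝓙 : Finset (Ideal (𝓞 K))) {α β : Ideal (𝓞 K) → ℝ}
    (hα0 : ∀ R, 0 ≤ α R) (hβ0 : ∀ J, 0 ≤ β J) :
    ∑ R ∈ 𝓡, ∑ J ∈ 𝓙, α R * β J * (classCountA X η d a b (R * J) : ℝ) ≤
      ∑ R ∈ 𝓡, ∑ J ∈ 𝓙, α R * β J * (countA X η (R * J) : ℝ) :=
  Finset.sum_le_sum fun R _ => Finset.sum_le_sum fun J _ =>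
    mul_le_mul_of_nonneg_left (by exact_mod_cast classCountA_le_countA X η d a b (R * J))
      (mul_nonneg (hα0 R) (hβ0 J))

end PairSums

end Summit.Parity.GeneralizedHardyLittlewood.Theorems.GoldbachHeathBrownDispersionHeathBrownMorozUniform

end
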